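import Mathlib
import HarnessLib
import Literature.Analysis.FluidPDE.ParabolicComparison

/-!
# Item `LrcModEntire` (stmt-NavierStokesRegularity-20428), registry twist_split v7 — ENTRANCE OF CELL (Q4) (memo `Cruxes/LrcModEntire/T2B-g14.md` §13b):
# on a HOMOGENEOUS ridge the tube-maximum points form a critical web whose first-order data depend on `(t, z)` only

LEAD of item 20428 ns-poloidal-K2-p3 g14 (`--supports stmt-NavierStokesRegularity-20428 --as helper`).  Class-free, elementary (Fermat).  After the hull machinery ((Q3∞), port-2 g5:
`…RidgeHull*`) one holds a profile whose tube-maximum function is arclength-independent: `F τ (γ s + nν s + z e₂) ≤ R τ z` for all `(τ, s, n, z)` near a base point, with equality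
at the web points.  At such a point `y₀ = γ s₀ + n₀ν s₀ + z₀e₂` (planar frame: `γ₂ = ν₂ = 0`; the frame map `Ψ(s,n,z) = γ s + nν s + z e₂` open at `(s₀,n₀,z₀)`, i.e.
`𝓝 y₀ ≤ map Ψ (𝓝 (s₀,n₀,z₀))` — from a tube chart) the space–time function `G(τ,y) = F τ y − R τ y₂` has a local maximum, so its derivative vanishes:

* `fderiv_uncurry_eq_of_ridgeWeb` — `D(uncurry F)(τ₀,y₀) = D(uncurry R)(τ₀,z₀) ∘ (τ, y) ↦ (τ, y₂)`: the time derivative of `F` at a web point is `∂_τR`, the vertical derivative is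
  `∂_zR`, and every horizontal derivative vanishes;
* `fderiv_slice_apply_of_ridgeWeb` — the slice form: `D(F τ₀)(y₀) h = ∂_zR(τ₀,z₀) · h₂` for every `h`.

WHAT THIS IS NOT: not a claim about Navier–Stokes regularity — the first-order bookkeeping at the entrance of the research cell (Q4) «HOMOGENEOUS NULL RIDGE» (bears_on LADDER-NS N0,
item 20428 / crux 19708; both OPEN, ⟨27893⟩ OPEN).
-/

set_option linter.style.longLine false
set_option linter.dupNamespace false

namespace Summit.NavierStokesRegularity.NavierStokesRegularity.Theorems.PoloidalWindowDoorLrcModEntireRidgeWebEntrance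

open Set Function Filter Topology

/-- The third coordinate of a point of the planar frame map `Ψ(s,n,z) = γ s + nν s + z e₂` is `z`. -/
theorem frame_apply_two {γ ν : ℝ → EuclideanSpace ℝ (Fin 3)} (hγ2 : ∀ s, γ s 2 = 0) (hν2 : ∀ s, ν s 2 = 0) (q : ℝ × ℝ × ℝ) :
    ((γ q.1 + q.2.1 • ν q.1 + q.2.2 • EuclideanSpace.single 2 (1 : ℝ) : EuclideanSpace ℝ (Fin 3))) 2 = q.2.2 := by
  simp [hγ2, hν2]

/-- **Fermat at a web point (space–time form).**  `F τ (Ψ(s,n,z)) ≤ R τ z` near `(τ₀, s₀, n₀, z₀)` with equality at the base point, `Ψ` open there, `F`, `R` differentiable ⇒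
`D(uncurry F)(τ₀, y₀) = D(uncurry R)(τ₀, z₀) ∘ ((τ, y) ↦ (τ, y₂))`. -/
theorem fderiv_uncurry_eq_of_ridgeWeb {F : ℝ → EuclideanSpace ℝ (Fin 3) → ℝ} {R : ℝ → ℝ → ℝ} {γ ν : ℝ → EuclideanSpace ℝ (Fin 3)}
    (hγ2 : ∀ s, γ s 2 = 0) (hν2 : ∀ s, ν s 2 = 0) {τ₀ : ℝ} {q₀ : ℝ × ℝ × ℝ}
    (hΨ : 𝓝 (γ q₀.1 + q₀.2.1 • ν q₀.1 + q₀.2.2 • EuclideanSpace.single 2 (1 : ℝ)) ≤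
      map (fun q : ℝ × ℝ × ℝ => γ q.1 + q.2.1 • ν q.1 + q.2.2 • EuclideanSpace.single 2 (1 : ℝ)) (𝓝 q₀))
    (hle : ∀ᶠ p in 𝓝 ((τ₀, q₀) : ℝ × (ℝ × ℝ × ℝ)), F p.1 (γ p.2.1 + p.2.2.1 • ν p.2.1 + p.2.2.2 • EuclideanSpace.single 2 (1 : ℝ)) ≤ R p.1 p.2.2.2)
    (heq : F τ₀ (γ q₀.1 + q₀.2.1 • ν q₀.1 + q₀.2.2 • EuclideanSpace.single 2 (1 : ℝ)) = R τ₀ q₀.2.2)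
    (hF : DifferentiableAt ℝ (uncurry F) (τ₀, γ q₀.1 + q₀.2.1 • ν q₀.1 + q₀.2.2 • EuclideanSpace.single 2 (1 : ℝ)))
    (hR : DifferentiableAt ℝ (uncurry R) (τ₀, q₀.2.2)) :
    fderiv ℝ (uncurry F) (τ₀, γ q₀.1 + q₀.2.1 • ν q₀.1 + q₀.2.2 • EuclideanSpace.single 2 (1 : ℝ)) =
      (fderiv ℝ (uncurry R) (τ₀, q₀.2.2)).comp
        ((ContinuousLinearMap.fst ℝ ℝ (EuclideanSpace ℝ (Fin 3))).prod
          ((EuclideanSpace.proj (2 : Fin 3)).comp (ContinuousLinearMap.snd ℝ ℝ (EuclideanSpace ℝ (Fin 3))))) := by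
  set Ψ : ℝ × ℝ × ℝ → EuclideanSpace ℝ (Fin 3) := fun q => γ q.1 + q.2.1 • ν q.1 + q.2.2 • EuclideanSpace.single 2 (1 : ℝ) with hΨdef
  set y₀ : EuclideanSpace ℝ (Fin 3) := Ψ q₀ with hy₀
  set L : ℝ × EuclideanSpace ℝ (Fin 3) →L[ℝ] ℝ × ℝ :=
    (ContinuousLinearMap.fst ℝ ℝ (EuclideanSpace ℝ (Fin 3))).prod
      ((EuclideanSpace.proj (2 : Fin 3)).comp (ContinuousLinearMap.snd ℝ ℝ (EuclideanSpace ℝ (Fin 3)))) with hL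
  have hLapply : ∀ p : ℝ × EuclideanSpace ℝ (Fin 3), L p = (p.1, p.2 2) := fun p => rfl
  have hΨ2 : ∀ q, Ψ q 2 = q.2.2 := fun q => frame_apply_two hγ2 hν2 q
  have hy2 : y₀ 2 = q₀.2.2 := hΨ2 q₀
  -- the comparison function `G = uncurry F − uncurry R ∘ L` has a local maximum `0` at `(τ₀, y₀)`
  set G : ℝ × EuclideanSpace ℝ (Fin 3) → ℝ := fun p => uncurry F p - uncurry R (L p) with hG
  have hG0 : G (τ₀, y₀) = 0 := by
    simp only [hG, uncurry_apply_pair, hLapply, hy2]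
    rw [sub_eq_zero]
    exact heq
  -- neighbourhoods of `(τ₀, y₀)` come from neighbourhoods of `(τ₀, q₀)` through `(τ, q) ↦ (τ, Ψ q)`
  have hnhds : 𝓝 ((τ₀, y₀) : ℝ × EuclideanSpace ℝ (Fin 3)) ≤ map (fun p : ℝ × (ℝ × ℝ × ℝ) => (p.1, Ψ p.2)) (𝓝 (τ₀, q₀)) := by
    rw [nhds_prod_eq, nhds_prod_eq]
    calc 𝓝 τ₀ ×ˢ 𝓝 y₀ ≤ 𝓝 τ₀ ×ˢ map Ψ (𝓝 q₀) := Filter.prod_mono le_rfl hΨ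
      _ = map id (𝓝 τ₀) ×ˢ map Ψ (𝓝 q₀) := by rw [Filter.map_id]
      _ = map (fun p : ℝ × (ℝ × ℝ × ℝ) => (id p.1, Ψ p.2)) (𝓝 τ₀ ×ˢ 𝓝 q₀) := Filter.prod_map_map_eq
      _ = map (fun p : ℝ × (ℝ × ℝ × ℝ) => (p.1, Ψ p.2)) (𝓝 τ₀ ×ˢ 𝓝 q₀) := rfl
  have hmax : IsLocalMax G (τ₀, y₀) := by
    rw [IsLocalMax, IsMaxFilter, hG0]
    refine hnhds ?_
    rw [Filter.mem_map]
    filter_upwards [hle] with p hp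
    simp only [Set.mem_preimage, Set.mem_setOf_eq, hG, uncurry_apply_pair, hLapply, hΨ2]
    linarith
  -- Fermat
  have hLd : HasFDerivAt (fun p : ℝ × EuclideanSpace ℝ (Fin 3) => L p) L (τ₀, y₀) := L.hasFDerivAt
  have hRL : HasFDerivAt (fun p : ℝ × EuclideanSpace ℝ (Fin 3) => uncurry R (L p)) ((fderiv ℝ (uncurry R) (τ₀, q₀.2.2)).comp L) (τ₀, y₀) := by
    have hR' : HasFDerivAt (uncurry R) (fderiv ℝ (uncurry R) (τ₀, q₀.2.2)) (L (τ₀, y₀)) := by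
      rw [hLapply, hy2]
      exact hR.hasFDerivAt
    exact hR'.comp (τ₀, y₀) hLd
  have hGd : HasFDerivAt G (fderiv ℝ (uncurry F) (τ₀, y₀) - (fderiv ℝ (uncurry R) (τ₀, q₀.2.2)).comp L) (τ₀, y₀) :=
    hF.hasFDerivAt.sub hRL
  have h0 := hmax.hasFDerivAt_eq_zero hGd
  exact sub_eq_zero.1 h0

/-- **Fermat at a web point (slice form).**  Under the same hypotheses, for every direction `h`: `D(F τ₀)(y₀) h = ∂_zR(τ₀, z₀) · h₂` — horizontal derivatives vanish, the vertical
one is the `z`-derivative of the level function. -/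
theorem fderiv_slice_apply_of_ridgeWeb {F : ℝ → EuclideanSpace ℝ (Fin 3) → ℝ} {R : ℝ → ℝ → ℝ} {γ ν : ℝ → EuclideanSpace ℝ (Fin 3)}
    (hγ2 : ∀ s, γ s 2 = 0) (hν2 : ∀ s, ν s 2 = 0) {τ₀ : ℝ} {q₀ : ℝ × ℝ × ℝ}
    (hΨ : 𝓝 (γ q₀.1 + q₀.2.1 • ν q₀.1 + q₀.2.2 • EuclideanSpace.single 2 (1 : ℝ)) ≤
      map (fun q : ℝ × ℝ × ℝ => γ q.1 + q.2.1 • ν q.1 + q.2.2 • EuclideanSpace.single 2 (1 : ℝ)) (𝓝 q₀))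
    (hle : ∀ᶠ p in 𝓝 ((τ₀, q₀) : ℝ × (ℝ × ℝ × ℝ)), F p.1 (γ p.2.1 + p.2.2.1 • ν p.2.1 + p.2.2.2 • EuclideanSpace.single 2 (1 : ℝ)) ≤ R p.1 p.2.2.2)
    (heq : F τ₀ (γ q₀.1 + q₀.2.1 • ν q₀.1 + q₀.2.2 • EuclideanSpace.single 2 (1 : ℝ)) = R τ₀ q₀.2.2)
    (hF : DifferentiableAt ℝ (uncurry F) (τ₀, γ q₀.1 + q₀.2.1 • ν q₀.1 + q₀.2.2 • EuclideanSpace.single 2 (1 : ℝ)))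
    (hR : DifferentiableAt ℝ (uncurry R) (τ₀, q₀.2.2)) (h : EuclideanSpace ℝ (Fin 3)) :
    fderiv ℝ (F τ₀) (γ q₀.1 + q₀.2.1 • ν q₀.1 + q₀.2.2 • EuclideanSpace.single 2 (1 : ℝ)) h =
      fderiv ℝ (uncurry R) (τ₀, q₀.2.2) (0, h 2) := by
  set y₀ : EuclideanSpace ℝ (Fin 3) := γ q₀.1 + q₀.2.1 • ν q₀.1 + q₀.2.2 • EuclideanSpace.single 2 (1 : ℝ) with hy₀
  have hmain := fderiv_uncurry_eq_of_ridgeWeb hγ2 hν2 hΨ hle heq hF hR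
  -- the slice `F τ₀ = uncurry F ∘ (τ₀, ·)`
  have hsl : HasFDerivAt (F τ₀) ((fderiv ℝ (uncurry F) (τ₀, y₀)).comp (ContinuousLinearMap.inr ℝ ℝ (EuclideanSpace ℝ (Fin 3)))) y₀ := by
    have h1 : HasFDerivAt (fun y : EuclideanSpace ℝ (Fin 3) => ((τ₀, y) : ℝ × EuclideanSpace ℝ (Fin 3)))
        (ContinuousLinearMap.inr ℝ ℝ (EuclideanSpace ℝ (Fin 3))) y₀ := hasFDerivAt_prodMk_right τ₀ y₀
    exact hF.hasFDerivAt.comp y₀ h1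
  rw [hsl.fderiv, hmain]
  rfl


/-- **The comparison function has a local maximum at a web point.**  Under the hypotheses of `fderiv_uncurry_eq_of_ridgeWeb` (no differentiability needed):
`(τ, y) ↦ F τ y − R τ y₂` has a local maximum (value `0`) at `(τ₀, y₀)`. -/
theorem isLocalMax_of_ridgeWeb {F : ℝ → EuclideanSpace ℝ (Fin 3) → ℝ} {R : ℝ → ℝ → ℝ} {γ ν : ℝ → EuclideanSpace ℝ (Fin 3)}
    (hγ2 : ∀ s, γ s 2 = 0) (hν2 : ∀ s, ν s 2 = 0) {τ₀ : ℝ} {q₀ : ℝ × ℝ × ℝ}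
    (hΨ : 𝓝 (γ q₀.1 + q₀.2.1 • ν q₀.1 + q₀.2.2 • EuclideanSpace.single 2 (1 : ℝ)) ≤
      map (fun q : ℝ × ℝ × ℝ => γ q.1 + q.2.1 • ν q.1 + q.2.2 • EuclideanSpace.single 2 (1 : ℝ)) (𝓝 q₀))
    (hle : ∀ᶠ p in 𝓝 ((τ₀, q₀) : ℝ × (ℝ × ℝ × ℝ)), F p.1 (γ p.2.1 + p.2.2.1 • ν p.2.1 + p.2.2.2 • EuclideanSpace.single 2 (1 : ℝ)) ≤ R p.1 p.2.2.2)
    (heq : F τ₀ (γ q₀.1 + q₀.2.1 • ν q₀.1 + q₀.2.2 • EuclideanSpace.single 2 (1 : ℝ)) = R τ₀ q₀.2.2) :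
    IsLocalMax (fun p : ℝ × EuclideanSpace ℝ (Fin 3) => F p.1 p.2 - R p.1 (p.2 2))
      (τ₀, γ q₀.1 + q₀.2.1 • ν q₀.1 + q₀.2.2 • EuclideanSpace.single 2 (1 : ℝ)) := by
  set Ψ : ℝ × ℝ × ℝ → EuclideanSpace ℝ (Fin 3) := fun q => γ q.1 + q.2.1 • ν q.1 + q.2.2 • EuclideanSpace.single 2 (1 : ℝ) with hΨdef
  set y₀ : EuclideanSpace ℝ (Fin 3) := Ψ q₀ with hy₀
  have hΨ2 : ∀ q, Ψ q 2 = q.2.2 := fun q => frame_apply_two hγ2 hν2 q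
  have hy2 : y₀ 2 = q₀.2.2 := hΨ2 q₀
  have hnhds : 𝓝 ((τ₀, y₀) : ℝ × EuclideanSpace ℝ (Fin 3)) ≤ map (fun p : ℝ × (ℝ × ℝ × ℝ) => (p.1, Ψ p.2)) (𝓝 (τ₀, q₀)) := by
    rw [nhds_prod_eq, nhds_prod_eq]
    calc 𝓝 τ₀ ×ˢ 𝓝 y₀ ≤ 𝓝 τ₀ ×ˢ map Ψ (𝓝 q₀) := Filter.prod_mono le_rfl hΨ
      _ = map id (𝓝 τ₀) ×ˢ map Ψ (𝓝 q₀) := by rw [Filter.map_id]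
      _ = map (fun p : ℝ × (ℝ × ℝ × ℝ) => (id p.1, Ψ p.2)) (𝓝 τ₀ ×ˢ 𝓝 q₀) := Filter.prod_map_map_eq
      _ = map (fun p : ℝ × (ℝ × ℝ × ℝ) => (p.1, Ψ p.2)) (𝓝 τ₀ ×ˢ 𝓝 q₀) := rfl
  have e0 : F τ₀ y₀ - R τ₀ (y₀ 2) = 0 := by
    rw [hy2, sub_eq_zero]
    exact heq
  rw [IsLocalMax, IsMaxFilter]
  refine hnhds ?_
  rw [Filter.mem_map]
  filter_upwards [hle] with p hp
  simp only [Set.mem_preimage, Set.mem_setOf_eq, hΨ2]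
  rw [e0]
  linarith

/-- **Second-order test at a web point, along any space–time line.**  Under the hypotheses of `isLocalMax_of_ridgeWeb` and continuity of `F`, `R` at the base point, for every
direction `(w₀, ξ)`: the second derivative at `0` of `r ↦ F(τ₀ + r w₀, y₀ + rξ) − R(τ₀ + r w₀, z₀ + r ξ₂)` is `≤ 0` — the kernel form of «`D²(F − R∘π) ≤ 0` on the web» (with the
slice PDE this yields the transversal curvature / tilt laws of memo §13). -/
theorem deriv_deriv_line_nonpos_of_ridgeWeb {F : ℝ → EuclideanSpace ℝ (Fin 3) → ℝ} {R : ℝ → ℝ → ℝ} {γ ν : ℝ → EuclideanSpace ℝ (Fin 3)}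
    (hγ2 : ∀ s, γ s 2 = 0) (hν2 : ∀ s, ν s 2 = 0) {τ₀ : ℝ} {q₀ : ℝ × ℝ × ℝ}
    (hΨ : 𝓝 (γ q₀.1 + q₀.2.1 • ν q₀.1 + q₀.2.2 • EuclideanSpace.single 2 (1 : ℝ)) ≤
      map (fun q : ℝ × ℝ × ℝ => γ q.1 + q.2.1 • ν q.1 + q.2.2 • EuclideanSpace.single 2 (1 : ℝ)) (𝓝 q₀))
    (hle : ∀ᶠ p in 𝓝 ((τ₀, q₀) : ℝ × (ℝ × ℝ × ℝ)), F p.1 (γ p.2.1 + p.2.2.1 • ν p.2.1 + p.2.2.2 • EuclideanSpace.single 2 (1 : ℝ)) ≤ R p.1 p.2.2.2)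
    (heq : F τ₀ (γ q₀.1 + q₀.2.1 • ν q₀.1 + q₀.2.2 • EuclideanSpace.single 2 (1 : ℝ)) = R τ₀ q₀.2.2)
    (hFc : ContinuousAt (uncurry F) (τ₀, γ q₀.1 + q₀.2.1 • ν q₀.1 + q₀.2.2 • EuclideanSpace.single 2 (1 : ℝ)))
    (hRc : ContinuousAt (uncurry R) (τ₀, q₀.2.2)) (w₀ : ℝ) (ξ : EuclideanSpace ℝ (Fin 3)) :
    deriv (deriv fun r : ℝ => F (τ₀ + r * w₀) (γ q₀.1 + q₀.2.1 • ν q₀.1 + q₀.2.2 • EuclideanSpace.single 2 (1 : ℝ) + r • ξ) -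
      R (τ₀ + r * w₀) (q₀.2.2 + r * ξ 2)) 0 ≤ 0 := by
  set y₀ : EuclideanSpace ℝ (Fin 3) := γ q₀.1 + q₀.2.1 • ν q₀.1 + q₀.2.2 • EuclideanSpace.single 2 (1 : ℝ) with hy₀
  have hy2 : y₀ 2 = q₀.2.2 := frame_apply_two hγ2 hν2 q₀
  have hmax := isLocalMax_of_ridgeWeb (F := F) (R := R) hγ2 hν2 hΨ hle heq
  -- the line `ℓ(r) = (τ₀ + r w₀, y₀ + r ξ)`
  have hℓ : Continuous fun r : ℝ => ((τ₀ + r * w₀, y₀ + r • ξ) : ℝ × EuclideanSpace ℝ (Fin 3)) := by fun_prop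
  have hℓ0 : ((τ₀ + 0 * w₀, y₀ + (0 : ℝ) • ξ) : ℝ × EuclideanSpace ℝ (Fin 3)) = (τ₀, y₀) := by simp
  have hcomp : IsLocalMax ((fun p : ℝ × EuclideanSpace ℝ (Fin 3) => F p.1 p.2 - R p.1 (p.2 2)) ∘
      fun r : ℝ => ((τ₀ + r * w₀, y₀ + r • ξ) : ℝ × EuclideanSpace ℝ (Fin 3))) 0 := by
    refine IsLocalMax.comp_continuous ?_ hℓ.continuousAt
    rw [hℓ0]; exact hmax
  have hline2 : ∀ r : ℝ, (y₀ + r • ξ) 2 = q₀.2.2 + r * ξ 2 := fun r => by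
    simp only [PiLp.add_apply, PiLp.smul_apply, smul_eq_mul, hy2]
  have hfun : ((fun p : ℝ × EuclideanSpace ℝ (Fin 3) => F p.1 p.2 - R p.1 (p.2 2)) ∘
      fun r : ℝ => ((τ₀ + r * w₀, y₀ + r • ξ) : ℝ × EuclideanSpace ℝ (Fin 3))) =
      fun r : ℝ => F (τ₀ + r * w₀) (y₀ + r • ξ) - R (τ₀ + r * w₀) (q₀.2.2 + r * ξ 2) := by
    funext r
    simp only [Function.comp_apply, hline2]
  rw [hfun] at hcomp
  -- continuity of the line function at `0`
  have hc : ContinuousAt (fun r : ℝ => F (τ₀ + r * w₀) (y₀ + r • ξ) - R (τ₀ + r * w₀) (q₀.2.2 + r * ξ 2)) 0 := by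
    have h1 : ContinuousAt ((uncurry F) ∘ fun r : ℝ => ((τ₀ + r * w₀, y₀ + r • ξ) : ℝ × EuclideanSpace ℝ (Fin 3))) 0 :=
      hFc.comp_of_eq hℓ.continuousAt hℓ0
    have hm : Continuous fun r : ℝ => ((τ₀ + r * w₀, q₀.2.2 + r * ξ 2) : ℝ × ℝ) := by fun_prop
    have hm0 : ((τ₀ + 0 * w₀, q₀.2.2 + 0 * ξ 2) : ℝ × ℝ) = (τ₀, q₀.2.2) := by simp
    have h2 : ContinuousAt ((uncurry R) ∘ fun r : ℝ => ((τ₀ + r * w₀, q₀.2.2 + r * ξ 2) : ℝ × ℝ)) 0 :=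
      hRc.comp_of_eq hm.continuousAt hm0
    exact h1.sub h2
  exact Literature.Analysis.FluidPDE.IsLocalMax.deriv_deriv_nonpos hcomp hc

end Summit.NavierStokesRegularity.NavierStokesRegularity.Theorems.PoloidalWindowDoorLrcModEntireRidgeWebEntrance
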